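import Literature.AlgebraicGeometry.HodgeTheory.GysinBaseChangeOfKunneth
import Literature.AlgebraicTopology.SingularHomology.KunnethFormula
import Literature.AlgebraicGeometry.Motives.AlgPointsProductProofs
import Literature.AlgebraicTopology.SingularHomology.CohomologyFiniteness
import HarnessLib

/-!
# Gysin base change for the product square (unconditional) and the composition of algebraic
# correspondences between surfaces (Buskin Lemma 6.3)

Family `hodge`, layer `Literature/AlgebraicGeometry/HodgeTheory`. Companion to
`GysinBaseChangeOfKunneth` (`gysin_baseChange_of_kunneth`: the base change
`snd_{X,Y}^* ∘ (fst_{Y,Z})_* = c • (X ◁ fst_{Y,Z})_* ∘ snd_{X,Y ⊗ Z}^*`, the hypothesis `hBC` of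
`corr_comp_of_baseChange` of `CorrespondenceComposition`, GRANTED the Künneth spanning property
`hK` on the complex points of products of smooth projective varieties) and to the tree's Künneth
formula (`AlgebraicTopology/SingularHomology/KunnethFormula`,
`LerayHirsch.kunneth_mem_span_of_field`: over a field, cross products span `H*(B × Y)` for `B` a
paracompact Hausdorff manifold and `Y` with finite-dimensional bounded cohomology; Hatcher
Thm. 3.15/3.16, obtained from the tree's Leray–Hirsch engine). Here the two are put together:

* `kunnethSpan_complexBetti` — the Künneth spanning property for `(Y ⊗ Z)(ℂ)`: every class of
  `Hᵏ((Y ⊗ Z)(ℂ); ℂ)` is a `ℂ`-linear combination of classes `fst^* b ∪ snd^* w`, for `Y`, `Z`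
  smooth projective over `ℂ` — `LerayHirsch.kunneth_mem_span_of_field` for the compact Hausdorff
  manifolds `Y(ℂ)`, `Z(ℂ)` (GAGA charts; finite-dimensionality `finite_singularCohomology_of_compact_chartedSpace`,
  vanishing above `2 dim Z`), transported along the homeomorphism `(Y ⊗ Z)(ℂ) ≃ₜ Y(ℂ) × Z(ℂ)`
  with components `fst(ℂ)`, `snd(ℂ)` (`AlgPoints.isHomeomorph_prodEquiv_holds`, Conrad Prop. 2.1);
* `gysin_baseChange` — **Gysin base change for the product square, for every orientation family
  and all smooth projective `X, Y, Z`** (Fulton, *Intersection Theory*, Prop. 1.7 / *Young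
  Tableaux* App. B, for the transversal square of projections), with an explicit scalar `c`:
  `gysin_baseChange_of_kunneth` fed with `kunnethSpan_complexBetti`;
* `corrComp_surfaces_of_cup`, `corrComp_surfaces_of_cup'` — **composition of algebraic
  correspondences between smooth projective surfaces** (Buskin, Lemma 6.3: "the class
  `π₁₃_*(π₁₂^*(α) ∪ π₂₃^*(β))` is also algebraic"; Fulton §16.1 Def. 16.1.1 / Prop. 16.1.1): for
  algebraic `γ ∈ N²H⁴((A ⊗ B)(ℂ))`, `γ₁ ∈ N²H⁴((B ⊗ C)(ℂ))` there is an algebraic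
  `γ₂ ∈ N²H⁴((A ⊗ C)(ℂ))` with `[γ₂]_* = [γ]_* ∘ [γ₁]_*` on `H²(C(ℂ); ℂ)`
  (`corr_comp_of_baseChange` + `gysin_baseChange` + `corrCompClass_mem_algebraicClasses`), GRANTED
  only `hCUP` : `N² ∪ N² ⊆ N⁴` on the triple products `A ⊗ (B ⊗ C)` (Voisin II Prop. 9.20; the
  moving-lemma input, a hypothesis in the tree by design, `AlgebraicClassesCup`). This is the
  hypothesis `hcomp₀` of `Surfaces/K3SurfaceProofs`' `Buskin2019_hodgeIsometry_algebraic_of_reflective_at`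
  (by specialisation to K3 surfaces), now reduced to `hCUP` alone.

Everything is proved; no named facts, no definitions; `hCUP` is a hypothesis.

## References

* [Fulton1998] W. Fulton, Intersection Theory, 2nd ed., Springer 1998, Prop. 1.7, §16.1.
* [FultonYoungTableaux1997] W. Fulton, Young Tableaux, CUP 1997, Appendix B §B.1 (4)–(6).
* [HatcherAT2002] A. Hatcher, Algebraic Topology, CUP 2002, §3.2 Thm. 3.15; Appendix Thm. A.7, Cor. A.9.
* [ConradAdelicPoints2012] B. Conrad, Weil and Grothendieck approaches to adelic points, Enseign.
  Math. 58 (2012), Prop. 2.1.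
* [Buskin2019] N. Buskin, Every rational Hodge isometry between two K3 surfaces is algebraic,
  J. reine angew. Math. 755 (2019), §6.2 Lemma 6.3.
* [VoisinHodgeII2003] C. Voisin, Hodge Theory and Complex Algebraic Geometry II, CUP 2003, §9.2.4 Prop. 9.20.
-/

noncomputable section

open CategoryTheory AlgebraicGeometry MonoidalCategory CartesianMonoidalCategory
open Literature.AlgebraicGeometry.Motives
open Literature.AlgebraicTopology.SingularHomology

namespace Literature.AlgebraicGeometry.HodgeTheory

section HodgeTheory

variable {l m n : ℕ} {X Y Z : SchemeOver ℂ}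

/-- **The Künneth spanning property for the complex points of a product of smooth projective
varieties**: every class of `Hᵏ((Y ⊗ Z)(ℂ); ℂ)` is a `ℂ`-linear combination of classes
`fst^* b ∪ snd^* w` (`b ∈ Hⁱ(Y(ℂ))`, `w ∈ Hʲ(Z(ℂ))`, `i + j = k`) — the Künneth formula for the
compact manifolds `Y(ℂ)`, `Z(ℂ)` (`LerayHirsch.kunneth_mem_span_of_field`, Hatcher Thm. 3.15/3.16)
transported along `(Y ⊗ Z)(ℂ) ≃ₜ Y(ℂ) × Z(ℂ)` (`AlgPoints.isHomeomorph_prodEquiv_holds`),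
a cohomology isomorphism taking the cross products `p₁^* b ⌣ p₂^* w` to `fst^* b ∪ snd^* w`.
[cite: HatcherAT2002, §3.2 Thm. 3.15] [cite: ConradAdelicPoints2012, Prop. 2.1] -/
theorem kunnethSpan_complexBetti (hY : IsSmoothProjective m Y) (hZ : IsSmoothProjective n Z) (k : ℕ)
    (z : complexBetti (Y ⊗ Z) k) :
    z ∈ Submodule.span ℂ
      {v | ∃ (i j : ℕ) (h : i + j = k) (b : complexBetti Y i) (w : complexBetti Z j),
        v = cupProduct h (complexBetti.map (fst Y Z) i b) (complexBetti.map (snd Y Z) j w)} := by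
  letI := hY.chartedSpace
  letI := hZ.chartedSpace
  haveI := ComplexPoints.compactSpace_of_isSmoothProjective hY
  haveI := ComplexPoints.t2Space_of_isSmoothProjective hY
  haveI := ComplexPoints.compactSpace_of_isSmoothProjective hZ
  haveI := ComplexPoints.t2Space_of_isSmoothProjective hZ
  haveI : ∀ k, Module.Finite ℂ (singularCohomology ℂ ℂ (ComplexPoints Z) k) :=
    fun k ↦ finite_singularCohomology_of_compact_chartedSpace ℂ ℂ (d := 2 * n) k
  have hN : ∀ k, 2 * n < k → Subsingleton (singularCohomology ℂ ℂ (ComplexPoints Z) k) :=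
    fun k hk ↦ ComplexPoints.subsingleton_singularCohomology_of_lt hZ ℂ hk
  -- the homeomorphism `(Y ⊗ Z)(ℂ) ≃ₜ Y(ℂ) × Z(ℂ)` and its components
  let e : ComplexPoints (Y ⊗ Z) ≃ₜ ComplexPoints Y × ComplexPoints Z :=
    IsHomeomorph.homeomorph _ (AlgPoints.isHomeomorph_prodEquiv_holds (X := Y) (Y := Z) (L := ℂ))
  have he₁ : (ContinuousMap.fst : C(ComplexPoints Y × ComplexPoints Z, ComplexPoints Y)).comp
      (e : C(ComplexPoints (Y ⊗ Z), ComplexPoints Y × ComplexPoints Z)) =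
      AlgPoints.mapContinuous (L := ℂ) (fst Y Z) := by
    refine ContinuousMap.ext fun P ↦ ?_
    change ((IsHomeomorph.homeomorph _
      (AlgPoints.isHomeomorph_prodEquiv_holds (X := Y) (Y := Z) (L := ℂ))) P).1 = AlgPoints.map (fst Y Z) P
    rw [IsHomeomorph.homeomorph_apply]
    rfl
  have he₂ : (ContinuousMap.snd : C(ComplexPoints Y × ComplexPoints Z, ComplexPoints Z)).comp
      (e : C(ComplexPoints (Y ⊗ Z), ComplexPoints Y × ComplexPoints Z)) =
      AlgPoints.mapContinuous (L := ℂ) (snd Y Z) := by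
    refine ContinuousMap.ext fun P ↦ ?_
    change ((IsHomeomorph.homeomorph _
      (AlgPoints.isHomeomorph_prodEquiv_holds (X := Y) (Y := Z) (L := ℂ))) P).2 = AlgPoints.map (snd Y Z) P
    rw [IsHomeomorph.homeomorph_apply]
    rfl
  -- `z = e^* z'` with `z' = (e⁻¹)^* z`
  have hz : singularCohomology.map ℂ ℂ (e : C(ComplexPoints (Y ⊗ Z), ComplexPoints Y × ComplexPoints Z)) k
      (singularCohomology.map ℂ ℂ (e.symm : C(ComplexPoints Y × ComplexPoints Z, ComplexPoints (Y ⊗ Z))) k z) =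
      z := by
    change ((singularCohomology.mapIso ℂ ℂ e k).inv ≫ (singularCohomology.mapIso ℂ ℂ e k).hom) z = z
    rw [Iso.inv_hom_id]
    rfl
  rw [← hz]
  refine Submodule.span_induction ?_ ?_ (fun x y _ _ hx hy ↦ ?_) (fun a x _ hx ↦ ?_)
    (LerayHirsch.kunneth_mem_span_of_field ℂ (B := ComplexPoints Y) (Y := ComplexPoints Z)
      (EuclideanSpace ℝ (Fin (2 * m))) hN k
      (singularCohomology.map ℂ ℂ
        (e.symm : C(ComplexPoints Y × ComplexPoints Z, ComplexPoints (Y ⊗ Z))) k z))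
  · rintro _ ⟨i, j, h, b, w, rfl⟩
    refine Submodule.subset_span ⟨i, j, h, b, w, ?_⟩
    rw [cupProduct_map, ← CategoryTheory.comp_apply, ← singularCohomology.map_comp, he₁,
      ← CategoryTheory.comp_apply, ← singularCohomology.map_comp, he₂]
  · rw [map_zero]
    exact Submodule.zero_mem _
  · rw [map_add]
    exact Submodule.add_mem _ hx hy
  · rw [map_smul]
    exact Submodule.smul_mem _ a hx

/-- **Gysin base change for the cartesian square of projections** `X ⊗ (Y ⊗ Z) → Y ⊗ Z` over
`X ⊗ Y → Y` (Fulton, *Intersection Theory*, Prop. 1.7; *Young Tableaux*, App. B): for smooth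
projective complex `X, Y, Z` (dimensions `l, m, n`), an orientation family `μ` and degrees
`k + 2m = k₁ + 2(m + n)`, there is `c ∈ ℂ` with
`snd_{X,Y}^* ((fst_{Y,Z})_* z) = c • (X ◁ fst_{Y,Z})_* (snd_{X, Y ⊗ Z}^* z)` for all
`z ∈ Hᵏ((Y ⊗ Z)(ℂ))` — the hypothesis `hBC` of `corr_comp_of_baseChange`, now a theorem
(`gysin_baseChange_of_kunneth` with the Künneth spanning property `kunnethSpan_complexBetti`).
[cite: Fulton1998, Prop. 1.7 and §16.1] [cite: FultonYoungTableaux1997, Appendix B §B.1 (5)–(6)]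
[cite: HatcherAT2002, §3.2 Thm. 3.15] -/
theorem gysin_baseChange (μ : OrientationFamily)
    (hX : IsSmoothProjective l X) (hY : IsSmoothProjective m Y) (hZ : IsSmoothProjective n Z)
    {k k₁ : ℕ} (hk : k + 2 * m = k₁ + 2 * (m + n)) :
    ∃ c : ℂ, ∀ z : complexBetti (Y ⊗ Z) k,
      complexBetti.map (snd X Y) k₁
        (complexGysin μ (IsSmoothProjective.tensor_holds hY hZ) hY (fst Y Z) hk z) =
      c • complexGysin μ
          (IsSmoothProjective.tensor_holds hX (IsSmoothProjective.tensor_holds hY hZ))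
          (IsSmoothProjective.tensor_holds hX hY) (X ◁ fst Y Z)
          (show k + 2 * (l + m) = k₁ + 2 * (l + (m + n)) by omega)
          (complexBetti.map (snd X (Y ⊗ Z)) k z) :=
  gysin_baseChange_of_kunneth μ hX hY hZ (fun _ _ _ _ hY' hZ' ↦ kunnethSpan_complexBetti hY' hZ') hk

/-! ### Composition of algebraic correspondences between surfaces (Buskin Lemma 6.3) -/


/-- **Composition of algebraic correspondences between smooth projective surfaces, from Künneth
and the multiplicativity of algebraic classes** (Buskin's Lemma 6.3 / Fulton Def. 16.1.1 in the
shape of the hypothesis `hcomp₀` of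
`Literature.AlgebraicGeometry.Surfaces.Buskin2019_hodgeIsometry_algebraic_of_reflective_at`, by specialisation
to K3 surfaces, and of hypothesis (C) of the Summits glue `…Theorems.similitudeAlgebraic_of_anchor`):
for algebraic `γ ∈ N²H⁴((A ⊗ B)(ℂ))`, `γ₁ ∈ N²H⁴((B ⊗ C)(ℂ))` there is an algebraic
`γ₂ ∈ N²H⁴((A ⊗ C)(ℂ))` with `[γ₂]_* = [γ]_* ∘ [γ₁]_*` on `H²(C(ℂ); ℂ)`, namely
`γ₂ = c • p₁₃_*(p₁₂^* γ ∪ p₂₃^* γ₁)` (`corr_comp_of_baseChange` with the base change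
`gysin_baseChange` of `GysinBaseChange`, and `corrCompClass_mem_algebraicClasses`), GRANTED the
multiplicativity `N² ∪ N² ⊆ N⁴` on the triple products `A ⊗ (B ⊗ C)` (`hCUP`,
Voisin II Prop. 9.20; the moving-lemma input of the tree's `cupProduct_mem_algebraicClasses_of_moving`).
[cite: Buskin2019, Lemma 6.3] [cite: Fulton1998, §16.1 Def. 16.1.1 and Prop. 16.1.1]
[cite: VoisinHodgeII2003, §9.2.4 Prop. 9.20] -/
theorem corrComp_surfaces_of_cup (μ : OrientationFamily)
    (hCUP : ∀ (A B C : SchemeOver ℂ), IsSmoothProjective 2 A → IsSmoothProjective 2 B →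
      IsSmoothProjective 2 C →
      ∀ a ∈ algebraicClasses (A ⊗ (B ⊗ C)) 2, ∀ b ∈ algebraicClasses (A ⊗ (B ⊗ C)) 2,
        cupProduct ((Nat.mul_add 2 2 2).symm : 2 * 2 + 2 * 2 = 2 * (2 + 2)) a b ∈
          algebraicClasses (A ⊗ (B ⊗ C)) (2 + 2))
    (A B C : SchemeOver ℂ) (hA : IsSmoothProjective 2 A) (hB : IsSmoothProjective 2 B)
    (hC : IsSmoothProjective 2 C) :
    ∀ γ ∈ algebraicClasses (A ⊗ B) 2, ∀ γ₁ ∈ algebraicClasses (B ⊗ C) 2,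
      ∃ γ₂ ∈ algebraicClasses (A ⊗ C) 2, ∀ x : complexBetti C (2 * 1),
        complexGysin μ (IsSmoothProjective.tensor_holds hA hC) hA (fst A C)
            (rfl : 2 * 1 + 2 * 2 + 2 * 2 = 2 * 1 + 2 * (2 + 2))
            (cupProduct (rfl : 2 * 1 + 2 * 2 = 2 * 1 + 2 * 2)
              (complexBetti.map (snd A C) (2 * 1) x) γ₂) =
          complexGysin μ (IsSmoothProjective.tensor_holds hA hB) hA (fst A B)
            (rfl : 2 * 1 + 2 * 2 + 2 * 2 = 2 * 1 + 2 * (2 + 2))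
            (cupProduct (rfl : 2 * 1 + 2 * 2 = 2 * 1 + 2 * 2)
              (complexBetti.map (snd A B) (2 * 1)
                (complexGysin μ (IsSmoothProjective.tensor_holds hB hC) hB (fst B C)
                  (rfl : 2 * 1 + 2 * 2 + 2 * 2 = 2 * 1 + 2 * (2 + 2))
                  (cupProduct (rfl : 2 * 1 + 2 * 2 = 2 * 1 + 2 * 2)
                    (complexBetti.map (snd B C) (2 * 1) x) γ₁)))
              γ) := by
  intro γ hγ γ₁ hγ₁
  have hμ : μ.HasPoincareDuality := OrientationFamily.hasPoincareDuality μ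
  obtain ⟨c, hc⟩ := gysin_baseChange μ hA hB hC (show 2 * 1 + 2 * 2 + 2 * 2 = 2 * 1 + 2 * (2 + 2) from rfl)
  refine ⟨c • complexGysin μ
      (IsSmoothProjective.tensor_holds hA (IsSmoothProjective.tensor_holds hB hC))
      (IsSmoothProjective.tensor_holds hA hC) (A ◁ snd B C)
      (show 2 * (2 + 2) + 2 * (2 + 2) = 2 * 2 + 2 * (2 + (2 + 2)) by omega)
      (cupProduct ((Nat.mul_add 2 2 2).symm : 2 * 2 + 2 * 2 = 2 * (2 + 2))
        (complexBetti.map (A ◁ fst B C) (2 * 2) γ) (complexBetti.map (snd A (B ⊗ C)) (2 * 2) γ₁)),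
    Submodule.smul_mem _ c (corrCompClass_mem_algebraicClasses hμ hA hB hC (e := 2) (e' := 2)
      (e'' := 2) rfl (hCUP A B C hA hB hC) hγ hγ₁), fun x ↦ ?_⟩
  exact corr_comp_of_baseChange hμ hA hB hC (e := 2) (j := 2 * 2) (k := 2 * 2) (d := 2 * (2 + 2))
    (a := 2 * 1) (a₁ := 2 * 1) (a₂ := 2 * 1) rfl rfl rfl ((Nat.mul_add 2 2 2).symm) γ γ₁ c hc x

/-- The same, quantified over orientation families with Poincaré duality (the shape consumed by
the Summits glue of the route NikulinTwinTransport's target, hypothesis (C) of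
`…Theorems.similitudeAlgebraic_of_anchor`), reduced to `hCUP`.
[cite: Buskin2019, Lemma 6.3] [cite: Fulton1998, §16.1 Def. 16.1.1 and Prop. 16.1.1] -/
theorem corrComp_surfaces_of_cup'
    (hCUP : ∀ (A B C : SchemeOver ℂ), IsSmoothProjective 2 A → IsSmoothProjective 2 B →
      IsSmoothProjective 2 C →
      ∀ a ∈ algebraicClasses (A ⊗ (B ⊗ C)) 2, ∀ b ∈ algebraicClasses (A ⊗ (B ⊗ C)) 2,
        cupProduct ((Nat.mul_add 2 2 2).symm : 2 * 2 + 2 * 2 = 2 * (2 + 2)) a b ∈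
          algebraicClasses (A ⊗ (B ⊗ C)) (2 + 2)) :
    ∀ (μ : OrientationFamily), μ.HasPoincareDuality →
      ∀ (A B C : SchemeOver ℂ) (hA : IsSmoothProjective 2 A) (hB : IsSmoothProjective 2 B)
        (hC : IsSmoothProjective 2 C),
        ∀ γ ∈ algebraicClasses (MonoidalCategoryStruct.tensorObj A B) 2,
          ∀ γ₁ ∈ algebraicClasses (MonoidalCategoryStruct.tensorObj B C) 2,
            ∃ γ₂ ∈ algebraicClasses (MonoidalCategoryStruct.tensorObj A C) 2,
              ∀ x : complexBetti C (2 * 1),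
                complexGysin μ (IsSmoothProjective.tensor_holds hA hC) hA
                    (SemiCartesianMonoidalCategory.fst A C)
                    (rfl : 2 * 1 + 2 * 2 + 2 * 2 = 2 * 1 + 2 * (2 + 2))
                    (cupProduct (rfl : 2 * 1 + 2 * 2 = 2 * 1 + 2 * 2)
                      (complexBetti.map (SemiCartesianMonoidalCategory.snd A C) (2 * 1) x) γ₂) =
                  complexGysin μ (IsSmoothProjective.tensor_holds hA hB) hA
                    (SemiCartesianMonoidalCategory.fst A B)
                    (rfl : 2 * 1 + 2 * 2 + 2 * 2 = 2 * 1 + 2 * (2 + 2))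
                    (cupProduct (rfl : 2 * 1 + 2 * 2 = 2 * 1 + 2 * 2)
                      (complexBetti.map (SemiCartesianMonoidalCategory.snd A B) (2 * 1)
                        (complexGysin μ (IsSmoothProjective.tensor_holds hB hC) hB
                          (SemiCartesianMonoidalCategory.fst B C)
                          (rfl : 2 * 1 + 2 * 2 + 2 * 2 = 2 * 1 + 2 * (2 + 2))
                          (cupProduct (rfl : 2 * 1 + 2 * 2 = 2 * 1 + 2 * 2)
                            (complexBetti.map (SemiCartesianMonoidalCategory.snd B C) (2 * 1) x)
                            γ₁)))
                      γ) :=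
  fun μ _ A B C hA hB hC ↦ corrComp_surfaces_of_cup μ hCUP A B C hA hB hC

end HodgeTheory

end Literature.AlgebraicGeometry.HodgeTheory

end
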